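import Literature.AnabelianGeometry.SemiGraphs.TemperedLocalLevelEstrangementSame
import Literature.AnabelianGeometry.SemiGraphs.TemperedHbddOfLocalLevelEstrangement
import Literature.AnabelianGeometry.SemiGraphs.TemperedCompactInVerticialAtOfNoEscape
import Literature.AnabelianGeometry.SemiGraphs.TemperedGroupsLimitFinite
import HarnessLib

/-!
# [SemiAnbd] Thm 3.7 (iii) beyond finite `𝔾`: the binder `hbdd` is a THEOREM at every LOCALLY FINITE `𝒢`;
# Thm 3.7 (iii) at a locally finite countable `𝒢` from the existence bound `hdisp` ALONE

Mochizuki, *Semi-graphs of anabelioids*, Publ. RIMS **42** (2006), §3, Theorem 3.7 (iii), manuscript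
pp. 40–41 ("if `H` fixes two vertices of `𝒢_{∞,j}`, then these two vertices are joined to one another by a
single edge"), with the author's *Comments* (2020) (6)(b) [cite: MochizukiSemiAnbd2006, Thm 3.7(iii) pp.40-41].

PROOF-ONLY ASSEMBLY (cell abc-iut, layer L3, GAP row G-t6g3-2b «no escape»; seat abc-iut-w6-d062, brick B3′
of the desk memo HOME/staging/w6/w6-d062/HBDD-LOCFIN-memo.md).  The programme of the memo in the kernel:

* `localLevelEstranged_temperedPiChart` — the LOCAL level-estrangement binder (LE_C,w) of
  `VerticialLevelData.hbdd_of_localLevelEstranged` (`TemperedHbddOfLocalLevelEstrangement.lean`) HOLDS at the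
  canonical level data `verticialLevelData_temperedPiChart h36` of every `𝒢` satisfying the hypotheses of
  Thm. 3.7 whose underlying semi-graph is LOCALLY FINITE, for every subgroup `C ≠ 1` (no compactness): at a
  vertex `w` (finitely many branches) pick `c ∈ C`, `c ≠ 1`, a level `j₀` with `ρ_{j₀}(c) ≠ 1`, and combine
  estrangement in depth for DISTINCT base branches (`eventually_not_fixed_pair_of_ne_base`,
  `TemperedLocalLevelEstrangementDistinct.lean`) with the SAME-base-branch fold
  (`eventually_fold_same_base_pair`, `TemperedLocalLevelEstrangementSame.lean`);
* **`hbdd_temperedPiChart_of_isLocallyFinite`** — hence the second «no escape» bound `hbdd` of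
  abc-iut-L3-t10's `compactInVerticialAt_of_noEscape` (p432183) is a THEOREM at every locally finite `𝒢`
  (bound `4` in subdivision distance; stated for all `C ≠ ⊥`, compact or not);
* **`compactInVerticialAt_of_hdisp_of_isLocallyFinite`** — [SemiAnbd] Thm 3.7 (iii) AT a locally finite
  countable `𝒢` from the EXISTENCE bound `hdisp` alone.  After abc-iut-L3-d1's countermodel `𝒢_θ` (a
  locally finite ray where `hdisp` fails) this is the sharp form of the erratum picture: at locally finite
  graphs the «no escape» core G-t6g3-2b IS the existence sentence; the uniqueness / edge sentences of
  Thm 3.7 (iii) carry no hypothesis beyond print's.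

Nothing here asserts `hdisp` for any `𝒢`; nothing here bears on [IUTchIII] Cor. 3.12; typed ≠ proved.
-/

namespace Literature.AnabelianGeometry.SemiGraphs

namespace ProfiniteSemiGraph

open CategoryTheory Topology

universe u

variable (𝒢 : ProfiniteSemiGraph.{u}) (h37 : 𝒢.Thm37Hypotheses)

/-- In a locally finite semi-graph every vertex carries finitely many branches (each abutting edge has
two). [cite: MochizukiSemiAnbd2006, §1 p.13] -/
theorem finite_branches_of_isLocallyFinite (hlf : 𝒢.graph.IsLocallyFinite) (w : 𝒢.graph.Vertex) :
    Set.Finite {b : 𝒢.graph.Branch | 𝒢.graph.abuts b = some w} := by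
  have hE := hlf.finite_edges w
  have hsub : {b : 𝒢.graph.Branch | 𝒢.graph.abuts b = some w} ⊆
      ⋃ e ∈ {e : 𝒢.graph.Edge | 𝒢.graph.EdgeAbuts e w}, {b : 𝒢.graph.Branch | 𝒢.graph.edgeOf b = e} := by
    intro b hb
    simp only [Set.mem_iUnion, Set.mem_setOf_eq, exists_prop]
    exact ⟨𝒢.graph.edgeOf b, ⟨b, rfl, hb⟩, rfl⟩
  refine (hE.biUnion fun e _ => ?_).subset hsub
  obtain ⟨b₁, b₂, -, -, -, hall⟩ := 𝒢.graph.two_branches e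
  exact ((Set.finite_singleton b₂).insert b₁).subset fun b hb => by
    rcases hall b hb with rfl | rfl
    · exact Set.mem_insert _ _
    · exact Set.mem_insert_of_mem _ (Set.mem_singleton _)

/-- A non-trivial element of `π₁^temp(𝒢) = lim_n Gal(𝒢_{∞,n}/𝒢)` is non-trivial at some level.
[cite: MochizukiSemiAnbd2006, Prop 3.6 p.38] -/
theorem exists_proj_ne_one (h36 : 𝒢.Prop36Hypotheses) (c : (𝒢.temperedPiChart h36).G) (hc : c ≠ 1) :
    ∃ j₀ : ℕ, (𝒢.galoisLevelData h36).proj h36.isCountable j₀ c ≠ 1 := by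
  by_contra hall
  refine hc (CountableDiscreteSystem.eq_one_of_forall_proj ((𝒢.galoisLevelData h36).system h36.isCountable) c
    fun i => ?_)
  rw [MonoidHom.mem_ker]
  by_contra hi
  exact hall ⟨i.down, hi⟩

/-- **The local level-estrangement binder (LE_C,w) holds at the canonical tower of a locally finite `𝒢`**
(for every subgroup `C ≠ 1`): for every base vertex `w` and level `j` there is a level from which on, at
tree vertices over `w`, two `C`-fixed edges of distinct branches at a common vertex have the same image in
`𝔾̃_j` — the two halves of estrangement in depth. [cite: MochizukiSemiAnbd2006, Thm 3.7(iii) p.41] -/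
theorem localLevelEstranged_temperedPiChart (hlf : 𝒢.graph.IsLocallyFinite)
    (C : Subgroup (𝒢.temperedPiChart h37.toProp36Hypotheses).G) (hC : C ≠ ⊥)
    (w : 𝒢.graph.Vertex) (j : ℕ) :
    ∃ (k : ℕ) (hjk : j ≤ k), ∀ (k' : ℕ) (hkk' : k ≤ k')
      (v : ((𝒢.galoisLevelData h37.toProp36Hypotheses).tree k').Vertex),
      ((𝒢.galoisLevelData h37.toProp36Hypotheses).treeProj k').vertexMap v = w →
      ∀ (b b' : ((𝒢.galoisLevelData h37.toProp36Hypotheses).tree k').Branch),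
      ((𝒢.galoisLevelData h37.toProp36Hypotheses).tree k').abuts b = some v →
      ((𝒢.galoisLevelData h37.toProp36Hypotheses).tree k').abuts b' = some v →
      ((𝒢.galoisLevelData h37.toProp36Hypotheses).tree k').edgeOf b ≠
        ((𝒢.galoisLevelData h37.toProp36Hypotheses).tree k').edgeOf b' →
      (∀ g ∈ C, ((𝒢.galoisLevelData h37.toProp36Hypotheses).treeAct h37.toProp36Hypotheses.isCountable k' g).hom.edgeMap
          (((𝒢.galoisLevelData h37.toProp36Hypotheses).tree k').edgeOf b) =
        ((𝒢.galoisLevelData h37.toProp36Hypotheses).tree k').edgeOf b) →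
      (∀ g ∈ C, ((𝒢.galoisLevelData h37.toProp36Hypotheses).treeAct h37.toProp36Hypotheses.isCountable k' g).hom.edgeMap
          (((𝒢.galoisLevelData h37.toProp36Hypotheses).tree k').edgeOf b') =
        ((𝒢.galoisLevelData h37.toProp36Hypotheses).tree k').edgeOf b') →
      ((𝒢.galoisLevelData h37.toProp36Hypotheses).treeTrans (hjk.trans hkk')).edgeMap
          (((𝒢.galoisLevelData h37.toProp36Hypotheses).tree k').edgeOf b) =
        ((𝒢.galoisLevelData h37.toProp36Hypotheses).treeTrans (hjk.trans hkk')).edgeMap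
          (((𝒢.galoisLevelData h37.toProp36Hypotheses).tree k').edgeOf b') := by
  classical
  -- a non-trivial element of `C` and a level where it is non-trivial
  obtain ⟨c, hcC, hc1⟩ : ∃ c ∈ C, c ≠ 1 := by
    by_contra h
    exact hC ((Subgroup.eq_bot_iff_forall C).mpr fun x hx => by
      by_contra hx1
      exact h ⟨x, hx, hx1⟩)
  obtain ⟨j₀, hc⟩ := 𝒢.exists_proj_ne_one h37.toProp36Hypotheses c hc1
  have hw := 𝒢.finite_branches_of_isLocallyFinite hlf w
  -- distinct base branches: eventually no `c`-fixed pair at all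
  obtain ⟨k₁, -, hk₁⟩ := 𝒢.eventually_not_fixed_pair_of_ne_base h37 c j₀ hc w hw
  -- same base branch: one fold level per branch at `w`, finitely many
  haveI : Finite {b : 𝒢.graph.Branch | 𝒢.graph.abuts b = some w} := hw.to_subtype
  have hk := fun b₀ : {b : 𝒢.graph.Branch | 𝒢.graph.abuts b = some w} =>
    𝒢.eventually_fold_same_base_pair h37 c j₀ hc w b₀.2 j
  choose kf hkf using hk
  obtain ⟨K, hK⟩ := (Set.finite_range kf).bddAbove
  refine ⟨max (max K k₁) j, le_max_right _ _, fun k' hkk' v hv b b' hb hb' hne hfix hfix' => ?_⟩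
  have hk₁k' : k₁ ≤ k' := ((le_max_right _ _).trans (le_max_left _ _)).trans hkk'
  by_cases hbase : ((𝒢.galoisLevelData h37.toProp36Hypotheses).treeProj k').branchMap b =
      ((𝒢.galoisLevelData h37.toProp36Hypotheses).treeProj k').branchMap b'
  · -- same base branch `b₀`: the fold
    have hb₀ : 𝒢.graph.abuts (((𝒢.galoisLevelData h37.toProp36Hypotheses).treeProj k').branchMap b) = some w := by
      rw [((𝒢.galoisLevelData h37.toProp36Hypotheses).treeProj k').abuts_branchMap b v hb, hv]
    let b₀ : {b : 𝒢.graph.Branch | 𝒢.graph.abuts b = some w} := ⟨_, hb₀⟩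
    have hkle : kf b₀ ≤ k' := ((hK ⟨b₀, rfl⟩).trans ((le_max_left _ _).trans (le_max_left _ _))).trans hkk'
    obtain ⟨P, hPv⟩ : ∃ P : (𝒢.galoisLevelData h37.toProp36Hypotheses).PointSeq h37.toProp36Hypotheses.isCountable w,
        P.vertex k' = v := by
      subst hv
      exact exists_pointSeq_vertex_eq_galoisLevelData h37.toProp36Hypotheses k' v
    rw [← hPv] at hb hb'
    have hfold := (hkf b₀).2.2 k' hkle P b b' rfl hbase.symm hb hb' (hfix c hcC) (hfix' c hcC)
      (le_trans (le_max_right _ _) hkk')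
    rw [← ((𝒢.galoisLevelData h37.toProp36Hypotheses).treeTrans _).edgeOf_branchMap b,
      ← ((𝒢.galoisLevelData h37.toProp36Hypotheses).treeTrans _).edgeOf_branchMap b', hfold]
  · -- distinct base branches: excluded at these levels
    exact (hk₁ k' hk₁k' v hv b b' hbase hb hb' (hfix c hcC) (hfix' c hcC)).elim

/-- **`hbdd` is a THEOREM at every locally finite `𝒢`**: at the canonical level data of the constructed chart,
any two compatible vertex systems fixed by a subgroup `C ≠ 1` of `π₁^temp(𝒢)` stay at subdivision distance
`≤ 4` at every level (the binder `hbdd` of `compactInVerticialAt_of_noEscape`, for all `C ≠ ⊥`).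
[cite: MochizukiSemiAnbd2006, Thm 3.7(iii) p.41] -/
theorem hbdd_temperedPiChart_of_isLocallyFinite (hlf : 𝒢.graph.IsLocallyFinite)
    (C : Subgroup (𝒢.temperedPiChart h37.toProp36Hypotheses).G) (hC : C ≠ ⊥)
    (x x' : ∀ j, ((verticialLevelData_temperedPiChart (h36 := h37.toProp36Hypotheses)).tree j).Vertex)
    (hx : ∀ ⦃i j : ℕ⦄ (hij : i ≤ j), ((verticialLevelData_temperedPiChart (h36 := h37.toProp36Hypotheses)).trans hij).vertexMap (x j) = x i)
    (hx' : ∀ ⦃i j : ℕ⦄ (hij : i ≤ j), ((verticialLevelData_temperedPiChart (h36 := h37.toProp36Hypotheses)).trans hij).vertexMap (x' j) = x' i)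
    (hfx : ∀ g ∈ C, ∀ j, ((verticialLevelData_temperedPiChart (h36 := h37.toProp36Hypotheses)).act j g).hom.vertexMap (x j) = x j)
    (hfx' : ∀ g ∈ C, ∀ j, ((verticialLevelData_temperedPiChart (h36 := h37.toProp36Hypotheses)).act j g).hom.vertexMap (x' j) = x' j) :
    ∃ N : ℕ, ∀ j, ((verticialLevelData_temperedPiChart (h36 := h37.toProp36Hypotheses)).tree j).subdivision.dist
      (Sum.inl (x j)) (Sum.inl (x' j)) ≤ N :=
  (verticialLevelData_temperedPiChart (h36 := h37.toProp36Hypotheses)).hbdd_of_localLevelEstranged C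
    (fun w j => 𝒢.localLevelEstranged_temperedPiChart h37 hlf C hC w j) x x' hx hx' hfx hfx'

/-- **[SemiAnbd] Theorem 3.7 (iii) AT a locally finite countable `𝒢` from the EXISTENCE bound alone**: if every
nontrivial compact subgroup of the constructed `π₁^temp(𝒢)` has a compatible base system of tree vertices
along which its elements have bounded displacement (`hdisp`), then `CompactInVerticialAt 𝒢` — every chart;
the adjacency bound `hbdd` of abc-iut-L3-t10's closer is DISCHARGED by local finiteness.
[cite: MochizukiSemiAnbd2006, Thm 3.7(iii) pp.40-41] -/
theorem compactInVerticialAt_of_hdisp_of_isLocallyFinite (hlf : 𝒢.graph.IsLocallyFinite)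
    (hdisp : ∀ (C : Subgroup (𝒢.temperedPiChart h37.toProp36Hypotheses).G), IsCompact (C : Set (𝒢.temperedPiChart h37.toProp36Hypotheses).G) → C ≠ ⊥ →
      ∃ x : ∀ j, ((verticialLevelData_temperedPiChart (h36 := h37.toProp36Hypotheses)).tree j).Vertex,
        (∀ ⦃i j : ℕ⦄ (hij : i ≤ j), ((verticialLevelData_temperedPiChart (h36 := h37.toProp36Hypotheses)).trans hij).vertexMap (x j) = x i) ∧
        ∀ g ∈ C, ∃ N : ℕ, ∀ j, ((verticialLevelData_temperedPiChart (h36 := h37.toProp36Hypotheses)).tree j).subdivision.dist (Sum.inl (x j))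
          (Sum.inl (((verticialLevelData_temperedPiChart (h36 := h37.toProp36Hypotheses)).act j g).hom.vertexMap (x j))) ≤ N) :
    CompactInVerticialAt 𝒢 :=
  compactInVerticialAt_of_noEscape h37 hdisp fun C _ hC x x' hx hx' hfx hfx' =>
    𝒢.hbdd_temperedPiChart_of_isLocallyFinite h37 hlf C hC x x' hx hx' hfx hfx'

end ProfiniteSemiGraph

end Literature.AnabelianGeometry.SemiGraphs
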